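import Summits.AnomalousDissipation.AnomalousDissipation.Theorems.SawtoothPulseCascadeK1LocalisedCascadeCanonicalRatioStepsLog2

/-!
# K1loc, line `Spectral` / thin start — helper: THE (O-V) STEP ALONG THE FAT SCHEDULE `K_j = K₀·25^j` (numeric layer)

Helper file of the prover lane on the crux `K1LocalisedCascade` (stmt-AnomalousDissipation-19491), route `SawtoothPulseCascade`
(S-B/S-C assembly seat; the LEDGER ASSEMBLY, numeric layer; companion of `…PhaseTH`/`…PhaseSV`).  The off-cone step (O-V)
along the fat schedule `K_j = K₀·25^j` (`K₀ ≥ 6`): class `O_{j+1} = Σ'[25K_j ≤ |k₀| ∧ |k₀| ≤ 4|k₁|]‖𝓕a_{j+1}‖²` (slope `(1,4)` at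
`X = K_{j+1} = 25K_j`), fibre floor `Λ₀ = 6K_j`, margin `β = 2`, `max`-family cut-offs with `t = 2/3`, `Y₀ = 3K_j` (feed = the SAME
sub-cone class `C_j = Σ'[3K_j+1 ≤ |k₀| ∧ |k₁| ≤ 3|k₀|]‖𝓕b_j‖²` as `…PhaseSV`), `M_b = 7j + 19`, `η_j = (ε/(A₄·8π·2^19·6K₀))·1600^{−j}`:
  `O_{j+1} ≤ (√J_O(j) + √C_j)² + ((1+γ)^{2(j+1)}/(6K_j·2^{7j+19}))²`,
  `J_O(j) = 3r₄²((4/3)ε² + 32·2^j·A₄/(6K_j) + 8(7j+19)A₄²(M_jδ_j)/π)`, `r₄ = 4/π + (2/π)log(97/47) + 1/47 + 1/(47²π)`,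
  `A₄ = 4/π + (2/π)log 7 + 1/72 + 1/(72²π)`.
No definitions; no statement about the crux.
[cite: Grafakos2014, Prop. 3.1.2 (5), Prop. 3.2.7 (3), §3.1.3] [cite: ElgindiLissMattingly2025, §1 (slope ±1 branches)] [problem: turb]
-/

-- `Summit.<Summit>.<Problem>`: single-conjunct summit, the duplicate namespace segment is deliberate.
set_option linter.dupNamespace false

noncomputable section

namespace Summit.AnomalousDissipation.AnomalousDissipation.Theorems.SawtoothPulseCascade.K1Window

open MeasureTheory Set Filter Topology UnitAddTorus Function Complex Metric
open scoped Real ENNReal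
open Literature.Analysis Literature.Analysis.FunctionSpaces Literature.Analysis.FunctionSpaces.Torus Literature.Analysis.FluidPDE
open Literature.Analysis.FluidPDE.ShearStage
open Literature.Analysis.FluidPDE.SawtoothCascade Literature.Analysis.FluidPDE.SawtoothCascade.CascadeParams
open Summit.AnomalousDissipation.AnomalousDissipation.Theorems.SawtoothPulseCascade.K1Start
open Summit.AnomalousDissipation.AnomalousDissipation.Theorems.SawtoothPulseCascade.K1Flat
open Summit.AnomalousDissipation.AnomalousDissipation.Theorems.SawtoothPulseCascade.K1Ledger.From

/-- **The log cut-off ratio of the fat (O-V) blocks is at most `r₄ = 4/π + (2/π)log(97/47) + 1/47 + 1/(47²π)`** (max family,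
`t = 2/3` with `3Y₀ ≤ 2Λ₀`, `β = 2`, `Λ₀ ≥ 36`). [folklore] -/
theorem offCone_logCutoff_le {Λ0 Y₀ : ℕ} (hΛ0 : 36 ≤ Λ0) (hY₀ : Y₀ * 3 ≤ 2 * Λ0) (m : ℕ) :
    4 / π + 2 / π * Real.log ((((max (2 * 1 * (Λ0 * 2 ^ m) / 3) Y₀ : ℕ) : ℝ) + ((2 * (Λ0 * 2 ^ m) / 1 : ℕ) : ℝ)) /
        (((2 * (Λ0 * 2 ^ m) / 1 : ℕ) : ℝ) - ((max (2 * 1 * (Λ0 * 2 ^ m) / 3) Y₀ : ℕ) : ℝ))) +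
      1 / (((2 * (Λ0 * 2 ^ m) / 1 : ℕ) : ℝ) - ((max (2 * 1 * (Λ0 * 2 ^ m) / 3) Y₀ : ℕ) : ℝ)) +
      1 / (π * (((2 * (Λ0 * 2 ^ m) / 1 : ℕ) : ℝ) - ((max (2 * 1 * (Λ0 * 2 ^ m) / 3) Y₀ : ℕ) : ℝ)) ^ 2) ≤
    4 / π + 2 / π * Real.log (97 / 47) + 1 / 47 + 1 / (π * 47 ^ 2) := by
  have h1 : 2 * 1 * 3 ≤ 2 * 3 := by norm_num
  have h3 : 2 * 1 * Λ0 + 2 * 1 * 3 ≤ 2 * 3 * Λ0 := by omega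
  have hQ := canonMax_Q₁_lt_Q₂ (u' := 1) (v' := 3) (Y₀ := Y₀) (tn := 2) (td := 3) (qn := 2) (qd := 1) (Λ0 := Λ0)
    (by norm_num) (by norm_num) (by norm_num) h1 hY₀ h3 m
  have hr := canonMax_r_le (u' := 1) (v' := 3) (Y₀ := Y₀) (tn := 2) (td := 3) (qn := 2) (qd := 1) (Λ0 := Λ0)
    (by norm_num) (by norm_num) (by norm_num) h1 hY₀ h3 m
  have hgap := canonMax_gap_le (u' := 1) (v' := 3) (Y₀ := Y₀) (tn := 2) (td := 3) (qn := 2) (qd := 1) (Λ0 := Λ0)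
    (by norm_num) (by norm_num) (by norm_num) h1 hY₀ h3 m
  have hΛ0r : (36 : ℝ) ≤ Λ0 := by exact_mod_cast hΛ0
  have hden : (0 : ℝ) < (((2 : ℕ) : ℝ) / ((1 : ℕ) : ℝ) - ((2 : ℕ) : ℝ) / ((3 : ℕ) : ℝ)) * (Λ0 : ℝ) - 1 := by
    push_cast; linarith
  have hrs : ((((2 : ℕ) : ℝ) / ((3 : ℕ) : ℝ) + ((2 : ℕ) : ℝ) / ((1 : ℕ) : ℝ)) * (Λ0 : ℝ) + 1) /
      ((((2 : ℕ) : ℝ) / ((1 : ℕ) : ℝ) - ((2 : ℕ) : ℝ) / ((3 : ℕ) : ℝ)) * (Λ0 : ℝ) - 1) ≤ 97 / 47 := by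
    rw [div_le_iff₀ hden]
    push_cast; linarith
  have hgap47 : (47 : ℝ) ≤ (((2 : ℕ) : ℝ) / ((1 : ℕ) : ℝ) - ((2 : ℕ) : ℝ) / ((3 : ℕ) : ℝ)) * (Λ0 : ℝ) - 1 := by
    push_cast; linarith
  have h := logCutoff_le_of_gap hQ hr (by norm_num : (0 : ℝ) < 47) (hgap47.trans hgap)
  refine h.trans ?_
  have hpos : 0 < ((((2 : ℕ) : ℝ) / ((3 : ℕ) : ℝ) + ((2 : ℕ) : ℝ) / ((1 : ℕ) : ℝ)) * (Λ0 : ℝ) + 1) /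
      ((((2 : ℕ) : ℝ) / ((1 : ℕ) : ℝ) - ((2 : ℕ) : ℝ) / ((3 : ℕ) : ℝ)) * (Λ0 : ℝ) - 1) := by
    refine div_pos ?_ hden
    push_cast; linarith
  exact logKernel_mono hpos hrs (by norm_num) le_rfl

section Cascade

variable (P : CascadeParams)

set_option maxHeartbeats 400000 in
/-- **(O-V) ALONG THE FAT SCHEDULE** (see the file header): the off-cone class of `a_{j+1}` above `K_{j+1} = 25K_j` is fed by the
sub-cone class `C_j` of `b_j` plus the closed-form Log2 junk `J_O(j)` plus the far tail. [cite: Grafakos2014, Prop. 3.1.2 (5), Prop. 3.2.7 (3), §3.1.3] -/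
theorem offCone_vstep_fat_le (hγ : P.γ = 8) (hδ₀ : 0 < P.δ₀) (hd : P.d = 2) (hN₀ : P.N₀ = 1) (hρN : P.ρN = 2)
    (a b : ℕ → UnitAddTorus (Fin 2) → ℝ) (has : ∀ j, IsSmooth (a j)) (h0 : a 0 = datum)
    (hb : ∀ j, b j = a j ∘ shearMap 0 1 (amp ⟨P.U j, P.U_periodic j, P.contDiff_U (P.δ_pos hδ₀ (by rw [hd]; norm_num) j)⟩ P.γ))
    (hab : ∀ j, a (j + 1) = b j ∘ shearMap 1 0 (amp ⟨P.U j, P.U_periodic j, P.contDiff_U (P.δ_pos hδ₀ (by rw [hd]; norm_num) j)⟩ P.γ))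
    {K₀ : ℕ} (hK₀ : 6 ≤ K₀) {ε : ℝ} (hε : 0 < ε) (j : ℕ)
    (hMδ : max 1 (Real.sqrt (2 * Real.log (1 / (ε / ((4 / π + 2 / π * Real.log 7 + 1 / 72 + 1 / (π * 72 ^ 2)) * π * 8 *
        2 ^ 19 * ((6 * K₀ : ℕ) : ℝ)) * (1 / 1600) ^ j)))) * P.δ j < π / 2) :
    ∑' k : Fin 2 → ℤ, (if ((25 * (K₀ * 25 ^ j) : ℕ) : ℤ) ≤ |k 0| ∧ ((1 : ℕ) : ℤ) * |k 0| ≤ ((4 : ℕ) : ℤ) * |k 1| then (1 : ℝ) else 0) *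
        ‖mFourierCoeff (fun x => (a (j + 1) x : ℂ)) k‖ ^ 2 ≤
      (Real.sqrt (3 * (4 / π + 2 / π * Real.log (97 / 47) + 1 / 47 + 1 / (π * 47 ^ 2)) ^ 2 *
            (4 / 3 * ε ^ 2 + 32 * 2 ^ j * (4 / π + 2 / π * Real.log 7 + 1 / 72 + 1 / (π * 72 ^ 2)) / ((6 * (K₀ * 25 ^ j) : ℕ) : ℝ) +
              8 * ((7 * j + 19 : ℕ) : ℝ) * (4 / π + 2 / π * Real.log 7 + 1 / 72 + 1 / (π * 72 ^ 2)) ^ 2 *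
                (max 1 (Real.sqrt (2 * Real.log (1 / (ε / ((4 / π + 2 / π * Real.log 7 + 1 / 72 + 1 / (π * 72 ^ 2)) * π * 8 *
                  2 ^ 19 * ((6 * K₀ : ℕ) : ℝ)) * (1 / 1600) ^ j)))) * P.δ j) / π)) +
          Real.sqrt (∑' k : Fin 2 → ℤ, (if ((3 * (K₀ * 25 ^ j) + 1 : ℕ) : ℤ) ≤ |k 0| ∧ ((1 : ℕ) : ℤ) * |k 1| ≤ ((3 : ℕ) : ℤ) * |k 0|
            then (1 : ℝ) else 0) * ‖mFourierCoeff (fun x => (b j x : ℂ)) k‖ ^ 2)) ^ 2 +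
        ((1 + P.γ) ^ (2 * (j + 1)) / (((6 * (K₀ * 25 ^ j)) * 2 ^ (7 * j + 19) : ℕ) : ℝ)) ^ 2 := by
  set Kj : ℕ := K₀ * 25 ^ j with hKjdef
  have hKj6 : 6 ≤ Kj := hK₀.trans (Nat.le_mul_of_pos_right _ (pow_pos (by norm_num) j))
  set Λ0 : ℕ := 6 * Kj with hΛ0def
  have hΛ06 : 36 ≤ Λ0 := by rw [hΛ0def]; omega
  have hΛ01 : 1 ≤ Λ0 := le_trans (by norm_num) hΛ06
  have hΛ0r : (36 : ℝ) ≤ Λ0 := by exact_mod_cast hΛ06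
  have hΛ0pos : (0 : ℝ) < Λ0 := by linarith
  have hγ' : P.γ = ((8 : ℕ) : ℝ) := by rw [hγ]; norm_num
  have hd' : 0 < P.d := by rw [hd]; norm_num
  have hN₀' : 1 ≤ P.N₀ := by rw [hN₀]
  have hρN' : 1 ≤ P.ρN := by rw [hρN]; norm_num
  have hNi : (P.N j : ℝ) = 2 ^ j := by rw [CascadeParams.N, hN₀, hρN]; push_cast; ring
  have hΛX : 4 * Λ0 ≤ 1 * (25 * Kj) := by rw [hΛ0def]; omega
  have h1 : 2 * 1 * 3 ≤ 2 * 3 := by norm_num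
  have h2 : (3 * Kj) * 3 ≤ 2 * Λ0 := by rw [hΛ0def]; omega
  have h3 : 2 * 1 * Λ0 + 2 * 1 * 3 ≤ 2 * 3 * Λ0 := by omega
  set A₁ : ℝ := 4 / π + 2 / π * Real.log 7 + 1 / 72 + 1 / (π * 72 ^ 2) with hA₁
  set r₁ : ℝ := 4 / π + 2 / π * Real.log (97 / 47) + 1 / 47 + 1 / (π * 47 ^ 2) with hr₁
  set η : ℝ := ε / (A₁ * π * 8 * 2 ^ 19 * ((6 * K₀ : ℕ) : ℝ)) * (1 / 1600) ^ j with hη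
  have hπ := Real.pi_pos
  have hlog7 : 0 ≤ Real.log 7 := Real.log_nonneg (by norm_num)
  have hA₁pos : 0 < A₁ := by rw [hA₁]; positivity
  have hηpos : 0 < η := by rw [hη]; positivity
  -- the packaged step
  have hstep := ratioClass_vstep_canonicalLog2_le P hγ' hδ₀ hd' hN₀' hρN' a b has h0 hb hab j (u := 1) (v := 4) (X := 25 * Kj)
    (u' := 1) (v' := 3) (Y := 3 * Kj + 1) (qn := 2) (qd := 1) (Λ0 := Λ0) (by norm_num) (by norm_num) (by norm_num) (by norm_num)
    (by norm_num) hΛ01 hΛX (fun m => max (2 * 1 * (Λ0 * 2 ^ m) / 3) (3 * Kj))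
    (fun m => canonMax_Q₁_lt_Q₂ (by norm_num) (by norm_num) (by norm_num) h1 h2 h3 m)
    (fun m => canonMax_feed (by norm_num) (3 * Kj) Λ0 m) (rs := r₁) (fun m => offCone_logCutoff_le hΛ06 h2 m)
    (fun m => canonMax_Y 1 3 (3 * Kj) Λ0 m) (7 * j + 19) hηpos hMδ
  -- the exact constants at `(u,v,q_n,q_d) = (1,4,2,1)`: log-argument `7`, `D₀ = 2Λ₀`, `τ₀ = 1/(4Λ₀)`
  have eratio : ((((4 : ℕ) : ℝ) + ((1 : ℕ) : ℝ) * ((8 : ℕ) : ℝ)) * ((1 : ℕ) : ℝ) + ((1 : ℕ) : ℝ) * ((2 : ℕ) : ℝ)) /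
      ((((1 : ℕ) : ℝ) * ((8 : ℕ) : ℝ) - ((4 : ℕ) : ℝ)) * ((1 : ℕ) : ℝ) - ((1 : ℕ) : ℝ) * ((2 : ℕ) : ℝ)) = 7 := by
    push_cast; norm_num
  have eD : ((((1 : ℕ) : ℝ) * ((8 : ℕ) : ℝ) - ((4 : ℕ) : ℝ)) * ((1 : ℕ) : ℝ) - ((1 : ℕ) : ℝ) * ((2 : ℕ) : ℝ)) * (Λ0 : ℝ) /
      (((1 : ℕ) : ℝ) * ((1 : ℕ) : ℝ)) = 2 * (Λ0 : ℝ) := by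
    push_cast; ring
  have eτ : ((1 : ℕ) : ℝ) * ((1 : ℕ) : ℝ) / (2 * (((((1 : ℕ) : ℝ) * ((8 : ℕ) : ℝ) - ((4 : ℕ) : ℝ)) * ((1 : ℕ) : ℝ) -
      ((1 : ℕ) : ℝ) * ((2 : ℕ) : ℝ)) * (Λ0 : ℝ))) = 1 / (4 * (Λ0 : ℝ)) := by
    push_cast; field_simp; ring
  set As : ℝ := 4 / π + 2 / π * Real.log (((((4 : ℕ) : ℝ) + ((1 : ℕ) : ℝ) * ((8 : ℕ) : ℝ)) * ((1 : ℕ) : ℝ) +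
      ((1 : ℕ) : ℝ) * ((2 : ℕ) : ℝ)) / ((((1 : ℕ) : ℝ) * ((8 : ℕ) : ℝ) - ((4 : ℕ) : ℝ)) * ((1 : ℕ) : ℝ) - ((1 : ℕ) : ℝ) * ((2 : ℕ) : ℝ))) +
      1 / (((((1 : ℕ) : ℝ) * ((8 : ℕ) : ℝ) - ((4 : ℕ) : ℝ)) * ((1 : ℕ) : ℝ) - ((1 : ℕ) : ℝ) * ((2 : ℕ) : ℝ)) * (Λ0 : ℝ) /
        (((1 : ℕ) : ℝ) * ((1 : ℕ) : ℝ))) +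
      1 / (π * (((((1 : ℕ) : ℝ) * ((8 : ℕ) : ℝ) - ((4 : ℕ) : ℝ)) * ((1 : ℕ) : ℝ) - ((1 : ℕ) : ℝ) * ((2 : ℕ) : ℝ)) * (Λ0 : ℝ) /
        (((1 : ℕ) : ℝ) * ((1 : ℕ) : ℝ))) ^ 2) with hAs
  have hAsle : As ≤ A₁ := by
    rw [hAs, eratio, eD, hA₁]
    have h12 : 1 / (2 * (Λ0 : ℝ)) ≤ 1 / 72 := one_div_le_one_div_of_le (by norm_num) (by linarith)
    have h144 : 1 / (π * (2 * (Λ0 : ℝ)) ^ 2) ≤ 1 / (π * 72 ^ 2) :=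
      one_div_le_one_div_of_le (by positivity)
        (mul_le_mul_of_nonneg_left (pow_le_pow_left₀ (by norm_num) (by linarith) 2) hπ.le)
    linarith
  have hAs0 : 0 ≤ As := by
    rw [hAs, eratio, eD]
    positivity
  set Mδ : ℝ := max 1 (Real.sqrt (2 * Real.log (1 / η))) * P.δ j with hMδdef
  have hMδ0 : 0 ≤ Mδ := by
    rw [hMδdef]
    exact mul_nonneg (le_trans zero_le_one (le_max_left _ _)) (P.δ_pos hδ₀ hd' j).le
  refine le_sq_sqrt_add_mono hstep ?_
  rw [eτ, hNi]
  have hX : As * π * ((8 : ℕ) : ℝ) * η * Λ0 / 2 ^ j * 2 ^ (7 * j + 19) = As * (ε / A₁) := by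
    have e2 : (2 : ℝ) ^ (7 * j + 19) = 2 ^ 19 * 128 ^ j := by
      rw [pow_add, pow_mul]; norm_num; ring
    have p1 : ((1 : ℝ) / 1600) ^ j * (25 : ℝ) ^ j * (128 : ℝ) ^ j = (2 : ℝ) ^ j := by
      rw [← mul_pow, ← mul_pow]; norm_num
    have eΛ : (Λ0 : ℝ) = 6 * (K₀ : ℝ) * 25 ^ j := by rw [hΛ0def, hKjdef]; push_cast; ring
    have e6 : ((6 * K₀ : ℕ) : ℝ) = 6 * (K₀ : ℝ) := by push_cast; ring
    have hK₀r : (6 : ℝ) ≤ K₀ := by exact_mod_cast hK₀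
    have hne1 : A₁ * Real.pi * 8 * 2 ^ 19 * (6 * (K₀ : ℝ)) ≠ 0 := by positivity
    have hne2 : (2 : ℝ) ^ j ≠ 0 := pow_ne_zero _ two_ne_zero
    rw [hη, e2, eΛ, e6]
    push_cast
    calc As * π * 8 * (ε / (A₁ * π * 8 * 2 ^ 19 * (6 * (K₀ : ℝ))) * (1 / 1600) ^ j) * (6 * (K₀ : ℝ) * 25 ^ j) / 2 ^ j *
          (2 ^ 19 * 128 ^ j)
        = As * (ε / A₁) * ((A₁ * Real.pi * 8 * 2 ^ 19 * (6 * (K₀ : ℝ))) / (A₁ * Real.pi * 8 * 2 ^ 19 * (6 * K₀))) *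
            ((((1 : ℝ) / 1600) ^ j * 25 ^ j * 128 ^ j) / 2 ^ j) := by
          field_simp
      _ = As * (ε / A₁) := by rw [p1, div_self hne1, div_self hne2]; ring
  have hXle : As * π * ((8 : ℕ) : ℝ) * η * Λ0 / 2 ^ j * 2 ^ (7 * j + 19) ≤ ε := by
    rw [hX]
    calc As * (ε / A₁) ≤ A₁ * (ε / A₁) := mul_le_mul_of_nonneg_right hAsle (by positivity)
      _ = ε := by field_simp
  have hX0 : 0 ≤ As * π * ((8 : ℕ) : ℝ) * η * Λ0 / 2 ^ j * 2 ^ (7 * j + 19) := by rw [hX]; positivity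
  have hr₁0 : 0 ≤ 3 * r₁ ^ 2 := by positivity
  refine mul_le_mul_of_nonneg_left ?_ hr₁0
  refine add_le_add (add_le_add ?_ ?_) ?_
  · exact mul_le_mul_of_nonneg_left (pow_le_pow_left₀ hX0 hXle 2) (by norm_num)
  · rw [show (128 : ℝ) * 2 ^ j * As * (1 / (4 * (Λ0 : ℝ))) = 32 * 2 ^ j * As / Λ0 by field_simp; ring]
    exact div_le_div_of_nonneg_right (mul_le_mul_of_nonneg_left hAsle (by positivity)) hΛ0pos.le
  · have : As ^ 2 ≤ A₁ ^ 2 := pow_le_pow_left₀ hAs0 hAsle 2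
    have := mul_le_mul_of_nonneg_left (mul_le_mul_of_nonneg_right this hMδ0) (by positivity : (0 : ℝ) ≤ 8 * ((7 * j + 19 : ℕ) : ℝ))
    have e : ∀ A : ℝ, 8 * ((7 * j + 19 : ℕ) : ℝ) * A ^ 2 * Mδ / π = 8 * ((7 * j + 19 : ℕ) : ℝ) * (A ^ 2 * Mδ) / π := fun A => by ring
    rw [e, e]
    exact div_le_div_of_nonneg_right this hπ.le

end Cascade

end Summit.AnomalousDissipation.AnomalousDissipation.Theorems.SawtoothPulseCascade.K1Window
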